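import Summits.Ventures.CertifiedManyBodySolver.Observables.PhaseSeparationExclusionParticleHole
import Literature.MathematicalPhysics.QuantumLattice.DWaveOrderParameterParticleHoleTTPrime
import HarnessLib

/-!
# Ventures/CertifiedManyBodySolver — Observables/PhaseSeparationExclusionParticleHoleColumns.lean: the particle–hole transport of the
# competing-order words, PART 2 — the `μ`-axis `T = 0` sentence (chemical-potential gap / «no `μ` carries both») at STATE level, the cell form
# of the periodic twin, and the REFLECTED COLUMN × THRESHOLD LAW for `T > 0` (the form every typed `T > 0` word of the strip files instantiates)

HONEST FRAMING: first certified bounds; not a superconductivity verdict. CLASS = TRANSPORT (generic, sorry-free theorems; no claim node, no number,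
no definition). Companion of `PhaseSeparationExclusionParticleHole.lean` (p703218: `T = 0` canonical sentence through the state map `ω ↦ ω ∘ α`,
bundle transport `reflected_cap/floor/anchor`, reflected `…_of_fns` laws). PRIOR ART IN THE TREE (cited, not restated): the point-level mirror of a
cap/floor TRIPLE `psT_strict_mirror_thresholds` / `psT_thresholds_mirror_not_groundState_mix_of_cap_lt` (hubbard-box-p3 g25,
`PhaseSeparationExclusionTPrimeCellsWeakFreeElectron.lean`, `t = 1`), and the `T > 0` `μ`-axis state-level transfer
`not_isVarEquilibrium_electronDoped_of_holeDoped` / `sub_chemPot_electronDoped_of_holeDoped` (`HubbardTTPrimeGrandCanonicalEquilibriumParticleHole.lean`,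
this seat g23). New here:
* §1 `μ` AXIS, `T = 0`, STATE LEVEL: `psGC_gap_particleHole` — a hole-side gap sentence «`μ₁` carries a pencil ground state of density `≤ n₁`, `μ₂` one of
  density `≥ n₂` ⇒ `g ≤ μ₂ − μ₁`» at `(t, s, U)` gives the same gap for the pair `(2 − n₂, 2 − n₁)` at `(t, −s, U)` (minimisers at `(s, μ)` ↦ minimisers at
  `(−s, U − μ)`, `IsMeanEnergyMinimiser.particleHole_tPrime`; `(U − μ₁) − (U − μ₂) = μ₂ − μ₁`); `psGC_noMu_particleHole` («no `μ` carries both»); cell forms.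
* §2 the CELL form of the periodic-components twin `ps_periodic_not_groundState_mix_particleHole_on_cell`.
* §3 `T > 0`, COLUMN × THRESHOLD FORM REFLECTED: `anchored_lt_of_columns_hotAnchorSS_tcap` (pure arithmetic: the column data of
  `psT_not_thermal_mix_on_cell_of_columns_hotAnchorSS_tcap` ⇒ the pointwise anchored inequality for the assembled bundle — cap `c₀ + c_s s + c₁ U`, dilute floor
  `F₁(s)`, `n₂`-floor = `U`-chord of the column laws, anchors `Q₁(s), Q₂(s)`) and `psT_not_thermal_mix_on_cell_of_columns_hotAnchorSS_tcap_reflected` — SAME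
  hypotheses as the column law, conclusion on the mirrored cell `[−s₂, −s₁] × [U₁, U₂]` for «(≤ 2 − n₂ ∣ ≥ 2 − n₁)» at every `β ≥ β₀` (through
  `psT_not_thermal_mix_on_cell_of_fns_hotAnchorFn_reflected`).
Instances: `Observables/PhaseSeparationExclusionElectronDopedMirror{,Thermal}.lean` (NCCO-type boxes on their own `t′ < 0` cells).
Cell `pub/hubbard-downfold` (MO-S1 ↔ S2 seam «box ↦ one word», filling direction), seat `hubbard-downfold-unc-2` (g28), 2026-08-29. Zero kit.
References: [cite: LiebPRL1989, proof of Theorem 2]; [cite: LiebWuPhysicaA2003, §1 eq. (3)]; [cite: Israel1979, Thm. I.2.4]; [cite: Ruelle1969, §3.3–3.4];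
[cite: PoulinHastings2011, eqs. (3)–(8)]; [cite: EmeryKivelsonLin1990, pp. 475–476].
-/

noncomputable section

namespace Summit.Ventures.CertifiedManyBodySolver.Observables

open Literature.MathematicalPhysics.QuantumLattice Literature.MathematicalPhysics.QuantumLattice.ThermodynamicLimit
open Literature.MathematicalPhysics.QuantumLattice.InfVolFermionState Set Filter

/-! ## §1 `μ` axis, `T = 0`: the gap sentence through the state map -/

/-- **PARTICLE–HOLE TRANSPORT OF THE `T = 0` CHEMICAL-POTENTIAL GAP (state level).** If at `(t, s, U)` every `μ₁` carrying a translation-invariant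
ground state of the pencil `H(t,s,U) − μ₁N` of density `≤ n₁` and every `μ₂` carrying one of density `≥ n₂` satisfy `g ≤ μ₂ − μ₁`, then at `(t, −s, U)` every
`μ₁` carrying one of density `≤ 2 − n₂` and every `μ₂` carrying one of density `≥ 2 − n₁` satisfy `g ≤ μ₂ − μ₁` (minimisers at `(−s, μ)` are carried by
`ω ↦ ω ∘ α` to minimisers at `(s, U − μ)` of density `2 − ρ`). [cite: LiebPRL1989, proof of Theorem 2] [cite: Israel1979, Thm. I.2.4] -/
theorem psGC_gap_particleHole (t s : ℝ) {U n₁ n₂ g : ℝ}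
    (hgap : ∀ ⦃μ₁ μ₂ : ℝ⦄ ⦃ω₁ ω₂ : InfVolFermionState 2⦄,
      ω₁.IsMeanEnergyMinimiser (hubbardTTPrimeMuInteraction t s U μ₁) 1 → ω₁.density ≤ n₁ →
      ω₂.IsMeanEnergyMinimiser (hubbardTTPrimeMuInteraction t s U μ₂) 1 → n₂ ≤ ω₂.density → g ≤ μ₂ - μ₁)
    {μ₁ μ₂ : ℝ} {ω₁ ω₂ : InfVolFermionState 2}
    (hω₁ : ω₁.IsMeanEnergyMinimiser (hubbardTTPrimeMuInteraction t (-s) U μ₁) 1) (hρ₁ : ω₁.density ≤ 2 - n₂)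
    (hω₂ : ω₂.IsMeanEnergyMinimiser (hubbardTTPrimeMuInteraction t (-s) U μ₂) 1) (hρ₂ : 2 - n₁ ≤ ω₂.density) :
    g ≤ μ₂ - μ₁ := by
  have k₁ := hω₁.particleHole_tPrime t (-s) U μ₁
  have k₂ := hω₂.particleHole_tPrime t (-s) U μ₂
  rw [neg_neg] at k₁ k₂
  have hd₁ : n₂ ≤ ω₁.particleHole.density := by rw [density_particleHole]; linarith
  have hd₂ : ω₂.particleHole.density ≤ n₁ := by rw [density_particleHole]; linarith
  have h := hgap k₂ hd₂ k₁ hd₁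
  linarith

/-- **CELL FORM**: a cell-uniform gap `g` for «(≤ n₁ ∣ ≥ n₂)» on `[s₁, s₂] × [U₁, U₂]` is the cell-uniform gap `g` for «(≤ 2 − n₂ ∣ ≥ 2 − n₁)» on
`[−s₂, −s₁] × [U₁, U₂]`. [cite: LiebPRL1989, proof of Theorem 2] [cite: Israel1979, Thm. I.2.4] -/
theorem psGC_gap_particleHole_on_cell (t : ℝ) {s₁ s₂ U₁ U₂ n₁ n₂ g : ℝ}
    (hgap : ∀ s ∈ Icc s₁ s₂, ∀ U ∈ Icc U₁ U₂, ∀ ⦃μ₁ μ₂ : ℝ⦄ ⦃ω₁ ω₂ : InfVolFermionState 2⦄,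
      ω₁.IsMeanEnergyMinimiser (hubbardTTPrimeMuInteraction t s U μ₁) 1 → ω₁.density ≤ n₁ →
      ω₂.IsMeanEnergyMinimiser (hubbardTTPrimeMuInteraction t s U μ₂) 1 → n₂ ≤ ω₂.density → g ≤ μ₂ - μ₁)
    {s : ℝ} (hs : s ∈ Icc (-s₂) (-s₁)) {U : ℝ} (hU : U ∈ Icc U₁ U₂)
    {μ₁ μ₂ : ℝ} {ω₁ ω₂ : InfVolFermionState 2}
    (hω₁ : ω₁.IsMeanEnergyMinimiser (hubbardTTPrimeMuInteraction t s U μ₁) 1) (hρ₁ : ω₁.density ≤ 2 - n₂)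
    (hω₂ : ω₂.IsMeanEnergyMinimiser (hubbardTTPrimeMuInteraction t s U μ₂) 1) (hρ₂ : 2 - n₁ ≤ ω₂.density) :
    g ≤ μ₂ - μ₁ := by
  have hs' : -s ∈ Icc s₁ s₂ := neg_mem_Icc_of_mem_Icc_neg hs
  have hω₁' : ω₁.IsMeanEnergyMinimiser (hubbardTTPrimeMuInteraction t (-(-s)) U μ₁) 1 := by rwa [neg_neg]
  have hω₂' : ω₂.IsMeanEnergyMinimiser (hubbardTTPrimeMuInteraction t (-(-s)) U μ₂) 1 := by rwa [neg_neg]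
  exact psGC_gap_particleHole t (-s) (hgap (-s) hs' U hU) hω₁' hρ₁ hω₂' hρ₂

/-- **«NO `μ` CARRIES BOTH» through the state map**: a POSITIVE cell-uniform gap for «(≤ n₁ ∣ ≥ n₂)» on `[s₁, s₂] × [U₁, U₂]` implies that on
`[−s₂, −s₁] × [U₁, U₂]` no chemical potential carries both a translation-invariant ground state of density `≤ 2 − n₂` and one of density `≥ 2 − n₁`.
[cite: LiebPRL1989, proof of Theorem 2] [cite: Israel1979, Thm. I.2.4] [cite: Ruelle1969, §3.4] -/
theorem psGC_noMu_particleHole_on_cell (t : ℝ) {s₁ s₂ U₁ U₂ n₁ n₂ g : ℝ} (hg : 0 < g)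
    (hgap : ∀ s ∈ Icc s₁ s₂, ∀ U ∈ Icc U₁ U₂, ∀ ⦃μ₁ μ₂ : ℝ⦄ ⦃ω₁ ω₂ : InfVolFermionState 2⦄,
      ω₁.IsMeanEnergyMinimiser (hubbardTTPrimeMuInteraction t s U μ₁) 1 → ω₁.density ≤ n₁ →
      ω₂.IsMeanEnergyMinimiser (hubbardTTPrimeMuInteraction t s U μ₂) 1 → n₂ ≤ ω₂.density → g ≤ μ₂ - μ₁)
    {s : ℝ} (hs : s ∈ Icc (-s₂) (-s₁)) {U : ℝ} (hU : U ∈ Icc U₁ U₂)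
    {μ : ℝ} {ω₁ ω₂ : InfVolFermionState 2}
    (hω₁ : ω₁.IsMeanEnergyMinimiser (hubbardTTPrimeMuInteraction t s U μ) 1) (hρ₁ : ω₁.density ≤ 2 - n₂)
    (hρ₂ : 2 - n₁ ≤ ω₂.density) :
    ¬ ω₂.IsMeanEnergyMinimiser (hubbardTTPrimeMuInteraction t s U μ) 1 := by
  intro hω₂
  have h := psGC_gap_particleHole_on_cell t hgap hs hU hω₁ hρ₁ hω₂ hρ₂
  linarith

/-! ## §2 The cell form of the periodic-components twin -/

/-- **PERIODIC-COMPONENTS TWIN ON THE MIRRORED CELL**: the translation-invariant «(≤ n₁ ∣ ≥ n₂)» sentence on `[s₁, s₂] × [U₁, U₂]` (`U₁ ≥ 0`) excludes,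
at every `(s, U)` of `[−s₂, −s₁] × [U₁, U₂]`, every mixture of two `q`-PERIODIC states (stripes / Néel / density waves with a common period lattice) of
cell fillings `0 < ρ̄(ω₁) ≤ 2 − n₂`, `2 − n₁ ≤ ρ̄(ω₂) < 2` from being a ground state.
[cite: LiebWuPhysicaA2003, §1 eq. (3)] [cite: Israel1979, Thm. I.2.4] [cite: BratteliRobinsonI1987, §4.3.1] -/
theorem ps_periodic_not_groundState_mix_particleHole_on_cell (t : ℝ) {s₁ s₂ U₁ U₂ n₁ n₂ : ℝ} (hU₁ : 0 ≤ U₁)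
    (hPS : ∀ s ∈ Icc s₁ s₂, ∀ U ∈ Icc U₁ U₂, ∀ ⦃ω₁ ω₂ : InfVolFermionState 2⦄, ω₁.IsTranslationInvariant →
      ω₂.IsTranslationInvariant → 0 < ω₁.density → ω₁.density ≤ n₁ → n₂ ≤ ω₂.density → ω₂.density < 2 →
      ∀ ⦃lam : ℝ⦄ (hl0 : 0 < lam) (hl1 : lam < 1),
      energyDensityTT' t s U (mix lam hl0.le hl1.le ω₁ ω₂).density <
        (mix lam hl0.le hl1.le ω₁ ω₂).meanEnergy (hubbardTTPrimeFermionInteraction t s U) 1)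
    {s : ℝ} (hs : s ∈ Icc (-s₂) (-s₁)) {U : ℝ} (hU : U ∈ Icc U₁ U₂)
    {q : Fin 2 → ℕ} {ω₁ ω₂ : InfVolFermionState 2} (h₁ : ω₁.IsPeriodic q) (h₂ : ω₂.IsPeriodic q)
    (hρ₁ : 0 < ω₁.cellFilling q) (hρ₁' : ω₁.cellFilling q ≤ 2 - n₂) (hρ₂ : 2 - n₁ ≤ ω₂.cellFilling q)
    (hρ₂' : ω₂.cellFilling q < 2) {lam : ℝ} (hl0 : 0 < lam) (hl1 : lam < 1) :
    energyDensityTT' t s U ((mix lam hl0.le hl1.le ω₁ ω₂).cellFilling q) <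
      (mix lam hl0.le hl1.le ω₁ ω₂).cellEnergy (fun _ : Cell q => hubbardTTPrimeFermionInteraction t s U) 1 :=
  IsPeriodic.energyDensityTT'_lt_cellEnergy_mix_of_forall_isTranslationInvariant_thresholds t s U
    (fun _ _ k₁ k₂ a' b' c' e' _ hl0' hl1' =>
      ps_not_groundState_mix_particleHole_on_cell t hU₁ hPS hs hU k₁ k₂ a' b' c' e' hl0' hl1')
    h₁ h₂ hρ₁ hρ₁' hρ₂ hρ₂' hl0 hl1

/-! ## §3 `T > 0`: the column × threshold form, reflected -/

/-- **Column data ⇒ pointwise anchored inequality (pure arithmetic).** On `[s₁, s₂] × [U₁, U₂]` (`U₁ < U₂`), with cap `c₀ + c_s s + c₁ U`, dilute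
floor `F₁(s)`, `n₂`-floor the `U`-CHORD of two column values `L₁(s), L₂(s)`, anchors `Q₁(s), Q₂(s)`, `0 ≤ β_{h,2}`, `0 < β₀ ≤ β`: if on BOTH columns the
`T = 0` margin is `≥ 0` and the anchored inequality holds at `β₀`, then at every `(s, U)` of the cell
`aQ₁ + bQ₂ + β_{h,1}aF₁ + β_{h,2}b·chord < β·(aF₁ + b·chord − cap)` (everything is affine in `U`). [folklore] [cite: Ruelle1969, §3.3] -/
theorem anchored_lt_of_columns_hotAnchorSS_tcap {s₁ s₂ U₁ U₂ a b c₀ cs c₁ β β₀ βh₁ βh₂ : ℝ} (h12 : U₁ < U₂)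
    (hβ₀ : β₀ ≤ β) {L₁ L₂ F₁ Q₁ Q₂ : ℝ → ℝ}
    (hm₁ : ∀ s ∈ Icc s₁ s₂, 0 ≤ a * F₁ s + b * L₁ s - (c₀ + cs * s + c₁ * U₁))
    (hm₂ : ∀ s ∈ Icc s₁ s₂, 0 ≤ a * F₁ s + b * L₂ s - (c₀ + cs * s + c₁ * U₂))
    (hg₁ : ∀ s ∈ Icc s₁ s₂,
      a * Q₁ s + b * Q₂ s + βh₁ * (a * F₁ s) + βh₂ * (b * L₁ s) < β₀ * (a * F₁ s + b * L₁ s - (c₀ + cs * s + c₁ * U₁)))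
    (hg₂ : ∀ s ∈ Icc s₁ s₂,
      a * Q₁ s + b * Q₂ s + βh₁ * (a * F₁ s) + βh₂ * (b * L₂ s) < β₀ * (a * F₁ s + b * L₂ s - (c₀ + cs * s + c₁ * U₂))) :
    ∀ s ∈ Icc s₁ s₂, ∀ U ∈ Icc U₁ U₂,
      a * Q₁ s + b * Q₂ s + βh₁ * (a * F₁ s) + βh₂ * (b * (((U₂ - U) * L₁ s + (U - U₁) * L₂ s) / (U₂ - U₁))) <
        β * (a * F₁ s + b * (((U₂ - U) * L₁ s + (U - U₁) * L₂ s) / (U₂ - U₁)) - (c₀ + cs * s + c₁ * U)) := by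
  intro s hs U hU
  have hd : (U₂ - U₁) ≠ 0 := (sub_pos.2 h12).ne'
  have e₁ : a * Q₁ s + b * Q₂ s <
      β₀ * (a * F₁ s + b * L₁ s - (c₀ + cs * s + c₁ * U₁)) - (βh₁ * (a * F₁ s) + βh₂ * (b * L₁ s)) := by
    have := hg₁ s hs; linarith
  have e₂ : a * Q₁ s + b * Q₂ s <
      β₀ * (a * F₁ s + b * L₂ s - (c₀ + cs * s + c₁ * U₂)) - (βh₁ * (a * F₁ s) + βh₂ * (b * L₂ s)) := by
    have := hg₂ s hs; linarith
  have hchord := chord_gt_of_ends_gt h12 hU e₁ e₂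
  have hid : β₀ * (a * F₁ s + b * (((U₂ - U) * L₁ s + (U - U₁) * L₂ s) / (U₂ - U₁)) - (c₀ + cs * s + c₁ * U)) -
        (βh₁ * (a * F₁ s) + βh₂ * (b * (((U₂ - U) * L₁ s + (U - U₁) * L₂ s) / (U₂ - U₁)))) =
      ((U₂ - U) * (β₀ * (a * F₁ s + b * L₁ s - (c₀ + cs * s + c₁ * U₁)) - (βh₁ * (a * F₁ s) + βh₂ * (b * L₁ s))) +
        (U - U₁) * (β₀ * (a * F₁ s + b * L₂ s - (c₀ + cs * s + c₁ * U₂)) - (βh₁ * (a * F₁ s) + βh₂ * (b * L₂ s)))) /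
        (U₂ - U₁) := by
    field_simp
    ring
  rw [← hid] at hchord
  have hge := chord_ge_of_ends_ge h12 hU (hm₁ s hs) (hm₂ s hs)
  have hidM : a * F₁ s + b * (((U₂ - U) * L₁ s + (U - U₁) * L₂ s) / (U₂ - U₁)) - (c₀ + cs * s + c₁ * U) =
      ((U₂ - U) * (a * F₁ s + b * L₁ s - (c₀ + cs * s + c₁ * U₁)) +
        (U - U₁) * (a * F₁ s + b * L₂ s - (c₀ + cs * s + c₁ * U₂))) / (U₂ - U₁) := by
    field_simp
    ring
  have hM : 0 ≤ a * F₁ s + b * (((U₂ - U) * L₁ s + (U - U₁) * L₂ s) / (U₂ - U₁)) - (c₀ + cs * s + c₁ * U) := hidM ▸ hge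
  have k := mul_le_mul_of_nonneg_right hβ₀ hM
  linarith

/-- **`T > 0` THERMAL PS EXCLUSION, COLUMN × THRESHOLD FORM, ON THE MIRRORED CELL.** Hypotheses EXACTLY as
`psT_not_thermal_mix_on_cell_of_columns_hotAnchorSS_tcap` with `0 < n₁` (source cell `[s₁, s₂] × [U₁, U₂]`, `0 ≤ U₁ < U₂`; cap `c₀ + c_s s + c₁ U` at `a n₁ + b n₂`;
column laws `L_i(s) ≤ e(t, s, U_i, n₂)`; dilute floor `F₁(s)`; anchors `p(β_{h,1}; n₁) ≤ Q₁(s)`, `p(β_{h,2}; n₂) ≤ Q₂(s)`, `0 ≤ β_{h,i} ≤ β₀ ≤ β`; both column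
margins `≥ 0` and the anchored inequality at `β₀` on both columns). CONCLUSION: at every `(s, U)` of the MIRRORED cell `[−s₂, −s₁] × [U₁, U₂]` no mixture
`λω₁ + (1−λ)ω₂` of translation-invariant states with `0 < ρ(ω₁) ≤ 2 − n₂`, `2 − n₁ ≤ ρ(ω₂) < 2` is a canonical thermal torus-limit state at `(β; t, s, U; n)`,
any `0 < n < 2` — the electron-doped edition of a hole-doped `T > 0` word, same threshold `β₀`.
[cite: LiebWuPhysicaA2003, §1 eq. (3)] [cite: Israel1979, Thm. I.2.4] [cite: PoulinHastings2011, eqs. (3)–(8)] [cite: Ruelle1969, §3.3] -/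
theorem psT_not_thermal_mix_on_cell_of_columns_hotAnchorSS_tcap_reflected (t : ℝ)
    {s₁ s₂ U₁ U₂ n₁ n₂ a b c₀ cs c₁ β β₀ βh₁ βh₂ : ℝ}
    (hU₁ : 0 ≤ U₁) (h12 : U₁ < U₂) (hn₁ : 0 < n₁) (hn : n₁ < n₂) (hn₂ : n₂ < 2) (ha : 0 ≤ a) (hb : 0 ≤ b)
    (hab : a + b = 1) (hβh₁ : 0 ≤ βh₁) (hβh₂ : 0 ≤ βh₂) (h0₁ : βh₁ ≤ β₀) (h0₂ : βh₂ ≤ β₀) (hβ₀ : β₀ ≤ β)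
    (hβ₀pos : 0 < β₀) {L₁ L₂ F₁ Q₁ Q₂ : ℝ → ℝ}
    (hC : ∀ s ∈ Icc s₁ s₂, ∀ U ∈ Icc U₁ U₂, energyDensityTT' t s U (a * n₁ + b * n₂) ≤ c₀ + cs * s + c₁ * U)
    (hL₁ : ∀ s ∈ Icc s₁ s₂, L₁ s ≤ energyDensityTT' t s U₁ n₂) (hL₂ : ∀ s ∈ Icc s₁ s₂, L₂ s ≤ energyDensityTT' t s U₂ n₂)
    (hF₁ : ∀ s ∈ Icc s₁ s₂, ∀ U ∈ Icc U₁ U₂, F₁ s ≤ energyDensityTT' t s U n₁)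
    (hπ₁ : ∀ s ∈ Icc s₁ s₂, ∀ U ∈ Icc U₁ U₂, pressureTT' βh₁ t s U n₁ ≤ Q₁ s)
    (hπ₂ : ∀ s ∈ Icc s₁ s₂, ∀ U ∈ Icc U₁ U₂, pressureTT' βh₂ t s U n₂ ≤ Q₂ s)
    (hm₁ : ∀ s ∈ Icc s₁ s₂, 0 ≤ a * F₁ s + b * L₁ s - (c₀ + cs * s + c₁ * U₁))
    (hm₂ : ∀ s ∈ Icc s₁ s₂, 0 ≤ a * F₁ s + b * L₂ s - (c₀ + cs * s + c₁ * U₂))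
    (hg₁ : ∀ s ∈ Icc s₁ s₂,
      a * Q₁ s + b * Q₂ s + βh₁ * (a * F₁ s) + βh₂ * (b * L₁ s) < β₀ * (a * F₁ s + b * L₁ s - (c₀ + cs * s + c₁ * U₁)))
    (hg₂ : ∀ s ∈ Icc s₁ s₂,
      a * Q₁ s + b * Q₂ s + βh₁ * (a * F₁ s) + βh₂ * (b * L₂ s) < β₀ * (a * F₁ s + b * L₂ s - (c₀ + cs * s + c₁ * U₂)))
    {s : ℝ} (hs : s ∈ Icc (-s₂) (-s₁)) {U : ℝ} (hU : U ∈ Icc U₁ U₂)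
    {ω₁ ω₂ : InfVolFermionState 2} (h₁ : ω₁.IsTranslationInvariant) (h₂ : ω₂.IsTranslationInvariant)
    (hρ₁ : 0 < ω₁.density) (hρ₁' : ω₁.density ≤ 2 - n₂) (hρ₂ : 2 - n₁ ≤ ω₂.density) (hρ₂' : ω₂.density < 2)
    {n : ℝ} (hn0 : 0 < n) (hn2 : n < 2) {lam : ℝ} (hl0 : 0 < lam) (hl1 : lam < 1) {Ls : ℕ → ℕ}
    (hLs : Tendsto Ls atTop atTop) :
    ¬ (mix lam hl0.le hl1.le ω₁ ω₂).IsTorusLimitOfMixture (sectorGibbsCount n) (fun L => sectorGibbsWeightTT' β t s U n L)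
      (fun L => sectorGibbsVectorTT' t s U n L) Ls := by
  have hn2' : 0 ≤ n₂ := hn₁.le.trans hn.le
  have hβpos : 0 < β := hβ₀pos.trans_le hβ₀
  exact psT_not_thermal_mix_on_cell_of_fns_hotAnchorFn_reflected t hU₁ hβpos hn₁ hn hn₂ ha hb hab hβh₁ hβh₂ (h0₁.trans hβ₀)
    (h0₂.trans hβ₀) (C := fun s U => c₀ + cs * s + c₁ * U) (F₁ := fun s _ => F₁ s)
    (F₂ := fun s U => ((U₂ - U) * L₁ s + (U - U₁) * L₂ s) / (U₂ - U₁)) (P₁ := fun s _ => Q₁ s) (P₂ := fun s _ => Q₂ s) hC hF₁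
    (floor_on_cell_of_columnLaws t hn2' hn₂ hU₁ h12 hL₁ hL₂) hπ₁ hπ₂
    (anchored_lt_of_columns_hotAnchorSS_tcap h12 hβ₀ hm₁ hm₂ hg₁ hg₂) hs hU h₁ h₂ hρ₁ hρ₁' hρ₂ hρ₂' hn0 hn2 hl0 hl1 hLs

/-! ## §4 `T > 0`: the above-column × threshold form, reflected (g28 append) -/

/-- **`T > 0` THERMAL PS EXCLUSION ABOVE A COLUMN, ON THE MIRRORED CELL.** Hypotheses EXACTLY as `psT_not_thermal_mix_above_column_hotAnchorSS_tcap`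
with `0 < n₁` (source cell `[s₁, s₂] × [U₂, U₃]`, `U₂ ≥ 0`; cap `c₀ + c_s s + c₁ U` with `c₁ ≥ 0` at `a n₁ + b n₂`; ONE column law `L(s) ≤ e(t, s, U₂, n₂)` — a floor
for every `U ≥ U₂` (Griffiths); dilute floor `F₁(s)`; anchors `Q₁(s), Q₂(s)` (`0 ≤ β_{h,i} ≤ β₀ ≤ β`); FAR-END margin `≥ 0` and anchored inequality at `(β₀, U₃)`
for every `s`). CONCLUSION: at every `(s, U)` of the MIRRORED cell `[−s₂, −s₁] × [U₂, U₃]` no mixture of translation-invariant states with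
`0 < ρ(ω₁) ≤ 2 − n₂`, `2 − n₁ ≤ ρ(ω₂) < 2` is a canonical thermal torus-limit state at `(β; t, s, U; n)`, any `0 < n < 2`, every `β ≥ β₀`.
[cite: LiebWuPhysicaA2003, §1 eq. (3)] [cite: Israel1979, Thm. I.2.4] [cite: Griffiths1966, §II] [cite: PoulinHastings2011, eqs. (3)–(8)] -/
theorem psT_not_thermal_mix_above_column_hotAnchorSS_tcap_reflected (t : ℝ)
    {s₁ s₂ U₂ U₃ n₁ n₂ a b c₀ cs c₁ β β₀ βh₁ βh₂ : ℝ}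
    (hU₂ : 0 ≤ U₂) (hc₁ : 0 ≤ c₁) (hn₁ : 0 < n₁) (hn : n₁ < n₂) (hn₂ : n₂ < 2) (ha : 0 ≤ a) (hb : 0 ≤ b)
    (hab : a + b = 1) (hβh₁ : 0 ≤ βh₁) (hβh₂ : 0 ≤ βh₂) (h0₁ : βh₁ ≤ β₀) (h0₂ : βh₂ ≤ β₀) (hβ₀ : β₀ ≤ β) (hβ₀pos : 0 < β₀)
    {L F₁ Q₁ Q₂ : ℝ → ℝ}
    (hC : ∀ s ∈ Icc s₁ s₂, ∀ U ∈ Icc U₂ U₃, energyDensityTT' t s U (a * n₁ + b * n₂) ≤ c₀ + cs * s + c₁ * U)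
    (hL : ∀ s ∈ Icc s₁ s₂, L s ≤ energyDensityTT' t s U₂ n₂)
    (hF₁ : ∀ s ∈ Icc s₁ s₂, ∀ U ∈ Icc U₂ U₃, F₁ s ≤ energyDensityTT' t s U n₁)
    (hπ₁ : ∀ s ∈ Icc s₁ s₂, ∀ U ∈ Icc U₂ U₃, pressureTT' βh₁ t s U n₁ ≤ Q₁ s)
    (hπ₂ : ∀ s ∈ Icc s₁ s₂, ∀ U ∈ Icc U₂ U₃, pressureTT' βh₂ t s U n₂ ≤ Q₂ s)
    (hm : ∀ s ∈ Icc s₁ s₂, 0 ≤ a * F₁ s + b * L s - (c₀ + cs * s + c₁ * U₃))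
    (hg : ∀ s ∈ Icc s₁ s₂,
      a * Q₁ s + b * Q₂ s + βh₁ * (a * F₁ s) + βh₂ * (b * L s) < β₀ * (a * F₁ s + b * L s - (c₀ + cs * s + c₁ * U₃)))
    {s : ℝ} (hs : s ∈ Icc (-s₂) (-s₁)) {U : ℝ} (hU : U ∈ Icc U₂ U₃)
    {ω₁ ω₂ : InfVolFermionState 2} (h₁ : ω₁.IsTranslationInvariant) (h₂ : ω₂.IsTranslationInvariant)
    (hρ₁ : 0 < ω₁.density) (hρ₁' : ω₁.density ≤ 2 - n₂) (hρ₂ : 2 - n₁ ≤ ω₂.density) (hρ₂' : ω₂.density < 2)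
    {n : ℝ} (hn0 : 0 < n) (hn2 : n < 2) {lam : ℝ} (hl0 : 0 < lam) (hl1 : lam < 1) {Ls : ℕ → ℕ}
    (hLs : Tendsto Ls atTop atTop) :
    ¬ (mix lam hl0.le hl1.le ω₁ ω₂).IsTorusLimitOfMixture (sectorGibbsCount n) (fun L => sectorGibbsWeightTT' β t s U n L)
      (fun L => sectorGibbsVectorTT' t s U n L) Ls := by
  have hn2' : 0 ≤ n₂ := hn₁.le.trans hn.le
  refine psT_not_thermal_mix_on_cell_of_fns_hotAnchorFn_reflected t hU₂ (hβ₀pos.trans_le hβ₀) hn₁ hn hn₂ ha hb hab hβh₁ hβh₂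
    (h0₁.trans hβ₀) (h0₂.trans hβ₀) (C := fun s U => c₀ + cs * s + c₁ * U) (F₁ := fun s _ => F₁ s) (F₂ := fun s _ => L s)
    (P₁ := fun s _ => Q₁ s) (P₂ := fun s _ => Q₂ s) hC hF₁
    (fun s hs U hU => floor_above_column_of_law t hn2' hn₂ hU₂ hL s hs U hU.1) hπ₁ hπ₂ ?_ hs hU h₁ h₂ hρ₁ hρ₁' hρ₂ hρ₂'
    hn0 hn2 hl0 hl1 hLs
  intro s hs U hU
  have k := mul_le_mul_of_nonneg_left hU.2 hc₁
  have hM3 := hm s hs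
  have hM : a * F₁ s + b * L s - (c₀ + cs * s + c₁ * U₃) ≤ a * F₁ s + b * L s - (c₀ + cs * s + c₁ * U) := by linarith
  have hMU : 0 ≤ a * F₁ s + b * L s - (c₀ + cs * s + c₁ * U) := hM3.trans hM
  have k1 := mul_le_mul_of_nonneg_left hM hβ₀pos.le
  have k2 := mul_le_mul_of_nonneg_right hβ₀ hMU
  have hg' := hg s hs
  show a * Q₁ s + b * Q₂ s + βh₁ * (a * F₁ s) + βh₂ * (b * L s) < β * (a * F₁ s + b * L s - (c₀ + cs * s + c₁ * U))
  linarith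

end Summit.Ventures.CertifiedManyBodySolver.Observables

end
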